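import Summits.Ventures.PercRepro.S2LPIncidence

/-!
# PercRepro — THE INSTANCES OF THE LEVEL-5 COLOOP/CLOSURE LP: SIZE FLOORS, PARTITIONS, `U`-SETS, CLOSURE BOUNDS
(p2, gen 30; SUBCLAIM-S2 feeder)

What a cell consumer needs besides `S2LPIncidence` and `S2LPClasses`: (i) the SIZE FLOORS of the classes — a `k`-set of
nullity `ν ≥ 1` has a core of at least `ν + 2` elements in a simple matroid (`ν + 3` for `ν ≥ 2` under lines `≤ 3`,
`ν + 4` for `ν ≥ 4` under planes `≤ 6`, `ν + 5` for `ν ≥ 7` under rank-`4` sets `≤ 10`, `ν + 6` for `ν ≥ 15` under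
rank-`5` sets `≤ 19`), so the classes below the floor are empty; (ii) the PARTITION of a rank class by core size;
(iii) the `U`-SETS by size, `U(p, q) = Σ_k #uSets k` with `#uSets k ≤ m[k, q]` and `#uSets k ≤ m[n − k, p]` (the
complement of a `U`-set spans); (iv) the rank classes of one size are at most `C(n, k)` in total; (v) the closure
instances `closure_exact` with the extension bounds of the coloop-free flat bound and of the flat sizes. Nothing is
claimed about any cell.

* `ncard_coloops_add_six_le_eRk_of_nineteen`, `nuSets_eq_empty_of_lt_two`, `nuSets_eq_empty_of_lt_three_of_lines`,
  `nuSets_eq_empty_of_lt_four_of_planes`, `nuSets_eq_empty_of_lt_five_of_tens`, `nuSets_eq_empty_of_lt_six_of_nineteen`,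
  `ncard_rkSets_eq_sum_nuSets`, `uSets`, `topCount_eq_sum_uSets`, `ncard_uSets_le_rkSets`, `ncard_uSets_le_rkSets_compl`,
  `sum_ncard_rkSets_le_choose`, `cl_exact_coloops`, `cl_exact_flat`.
Axioms: standard.
-/

open scoped Matroid

namespace PercRepro

namespace S2LP

open Set Finset

variable {α : Type} {M : Matroid α} [M.Finite]

section Floors

/-- **THE COLOOP COUNT UNDER «RANK-`5` SETS ≤ 19»** (with the smaller bounds): nullity `≥ 15` ⇒ at most `ρ(S) − 6`
coloops. -/
theorem ncard_coloops_add_six_le_eRk_of_nineteen (hpairs : ∀ e ∈ M.E, ∀ f ∈ M.E, e ≠ f → M.eRk {e, f} = 2)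
    (hlines : ∀ L ⊆ M.E, M.eRk L = 2 → L.ncard ≤ 3) (hplanes : ∀ P ⊆ M.E, M.eRk P ≤ 3 → P.ncard ≤ 6)
    (htens : ∀ X ⊆ M.E, M.eRk X ≤ 4 → X.ncard ≤ 10) (hnineteen : ∀ X ⊆ M.E, M.eRk X ≤ 5 → X.ncard ≤ 19)
    (hE2 : 2 ≤ M.E.ncard) {S : Set α} (hS : S ⊆ M.E) {r : ℕ} (hr : M.eRk S = (r : ℕ∞))
    (hdep : r + 15 ≤ S.ncard) : {x ∈ S | M.eRk (S \ {x}) + 1 = M.eRk S}.ncard + 6 ≤ r := by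
  obtain ⟨a, ha, hA, hsize, h2⟩ := S1.exists_eRk_sdiff_coloops hpairs hE2 hS hr (by omega)
  set C := {x ∈ S | M.eRk (S \ {x}) + 1 = M.eRk S} with hCdef
  have h5 := S1.ncard_coloops_add_five_le_eRk_of_tens hpairs hlines hplanes htens hE2 hS hr (by omega)
  rw [← hCdef] at h5
  by_contra hlt
  push Not at hlt
  have ha5 : a = 5 := by omega
  have := hnineteen (S \ C) (sdiff_subset.trans hS) (by rw [ha, ha5]; exact le_refl _)
  omega

/-- The coloop count in the vocabulary of the classes: a member of `nuSets k ν s` with `ν ≥ 1` has `k − s` coloops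
and rank `k − ν`. -/
theorem coloopsOf_ncard_of_mem_nuSets {k ν s : ℕ} {S : Set α} (hS : S ∈ nuSets M k ν s) :
    (coloopsOf M S).ncard = k - s ∧ S ⊆ M.E ∧ S.ncard = k ∧ M.eRk S = ((k - ν : ℕ) : ℕ∞) := by
  obtain ⟨⟨hSE, hSk, hSr⟩, hcore⟩ := hS
  have := ncard_core_add_ncard_coloopsOf (M := M) hSE
  rw [hcore, hSk] at this
  exact ⟨by omega, hSE, hSk, hSr⟩

/-- **SIZE FLOOR (simple)**: `nuSets k ν s = ∅` for `1 ≤ ν ≤ k` and `s < ν + 2`. -/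
theorem nuSets_eq_empty_of_lt_two (hpairs : ∀ e ∈ M.E, ∀ f ∈ M.E, e ≠ f → M.eRk {e, f} = 2)
    (hE2 : 2 ≤ M.E.ncard) {k ν s : ℕ} (hν : 1 ≤ ν) (hνk : ν ≤ k) (hs : s < ν + 2) : nuSets M k ν s = ∅ := by
  ext S
  simp only [mem_empty_iff_false, iff_false]
  intro hS
  obtain ⟨hC, hSE, hSk, hSr⟩ := coloopsOf_ncard_of_mem_nuSets hS
  have := S1.ncard_coloops_add_two_le_eRk hpairs hE2 hSE hSr (by omega)
  have hcs : (coloopsOf M S).ncard ≤ k := by rw [hC]; omega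
  simp only [coloopsOf] at hC
  omega

/-- **SIZE FLOOR (lines ≤ 3)**: `nuSets k ν s = ∅` for `2 ≤ ν ≤ k` and `s < ν + 3`. -/
theorem nuSets_eq_empty_of_lt_three_of_lines (hpairs : ∀ e ∈ M.E, ∀ f ∈ M.E, e ≠ f → M.eRk {e, f} = 2)
    (hlines : ∀ L ⊆ M.E, M.eRk L = 2 → L.ncard ≤ 3) (hE2 : 2 ≤ M.E.ncard) {k ν s : ℕ} (hν : 2 ≤ ν) (hνk : ν ≤ k)
    (hs : s < ν + 3) : nuSets M k ν s = ∅ := by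
  ext S
  simp only [mem_empty_iff_false, iff_false]
  intro hS
  obtain ⟨hC, hSE, hSk, hSr⟩ := coloopsOf_ncard_of_mem_nuSets hS
  have := S1.ncard_coloops_add_three_le_eRk_of_lines hpairs hlines hE2 hSE hSr (by omega)
  simp only [coloopsOf] at hC
  omega

/-- **SIZE FLOOR (planes ≤ 6)**: `nuSets k ν s = ∅` for `4 ≤ ν ≤ k` and `s < ν + 4`. -/
theorem nuSets_eq_empty_of_lt_four_of_planes (hpairs : ∀ e ∈ M.E, ∀ f ∈ M.E, e ≠ f → M.eRk {e, f} = 2)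
    (hlines : ∀ L ⊆ M.E, M.eRk L = 2 → L.ncard ≤ 3) (hplanes : ∀ P ⊆ M.E, M.eRk P ≤ 3 → P.ncard ≤ 6)
    (hE2 : 2 ≤ M.E.ncard) {k ν s : ℕ} (hν : 4 ≤ ν) (hνk : ν ≤ k) (hs : s < ν + 4) : nuSets M k ν s = ∅ := by
  ext S
  simp only [mem_empty_iff_false, iff_false]
  intro hS
  obtain ⟨hC, hSE, hSk, hSr⟩ := coloopsOf_ncard_of_mem_nuSets hS
  have := S1.ncard_coloops_add_four_le_eRk_of_planes hpairs hlines hplanes hE2 hSE hSr (by omega)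
  simp only [coloopsOf] at hC
  omega

/-- **SIZE FLOOR (rank-4 sets ≤ 10)**: `nuSets k ν s = ∅` for `7 ≤ ν ≤ k` and `s < ν + 5`. -/
theorem nuSets_eq_empty_of_lt_five_of_tens (hpairs : ∀ e ∈ M.E, ∀ f ∈ M.E, e ≠ f → M.eRk {e, f} = 2)
    (hlines : ∀ L ⊆ M.E, M.eRk L = 2 → L.ncard ≤ 3) (hplanes : ∀ P ⊆ M.E, M.eRk P ≤ 3 → P.ncard ≤ 6)
    (htens : ∀ X ⊆ M.E, M.eRk X ≤ 4 → X.ncard ≤ 10)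
    (hE2 : 2 ≤ M.E.ncard) {k ν s : ℕ} (hν : 7 ≤ ν) (hνk : ν ≤ k) (hs : s < ν + 5) : nuSets M k ν s = ∅ := by
  ext S
  simp only [mem_empty_iff_false, iff_false]
  intro hS
  obtain ⟨hC, hSE, hSk, hSr⟩ := coloopsOf_ncard_of_mem_nuSets hS
  have := S1.ncard_coloops_add_five_le_eRk_of_tens hpairs hlines hplanes htens hE2 hSE hSr (by omega)
  simp only [coloopsOf] at hC
  omega

/-- **SIZE FLOOR (rank-5 sets ≤ 19)**: `nuSets k ν s = ∅` for `15 ≤ ν ≤ k` and `s < ν + 6`. -/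
theorem nuSets_eq_empty_of_lt_six_of_nineteen (hpairs : ∀ e ∈ M.E, ∀ f ∈ M.E, e ≠ f → M.eRk {e, f} = 2)
    (hlines : ∀ L ⊆ M.E, M.eRk L = 2 → L.ncard ≤ 3) (hplanes : ∀ P ⊆ M.E, M.eRk P ≤ 3 → P.ncard ≤ 6)
    (htens : ∀ X ⊆ M.E, M.eRk X ≤ 4 → X.ncard ≤ 10) (hnineteen : ∀ X ⊆ M.E, M.eRk X ≤ 5 → X.ncard ≤ 19)
    (hE2 : 2 ≤ M.E.ncard) {k ν s : ℕ} (hν : 15 ≤ ν) (hνk : ν ≤ k) (hs : s < ν + 6) : nuSets M k ν s = ∅ := by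
  ext S
  simp only [mem_empty_iff_false, iff_false]
  intro hS
  obtain ⟨hC, hSE, hSk, hSr⟩ := coloopsOf_ncard_of_mem_nuSets hS
  have := ncard_coloops_add_six_le_eRk_of_nineteen hpairs hlines hplanes htens hnineteen hE2 hSE hSr (by omega)
  simp only [coloopsOf] at hC
  omega

end Floors

section Partition

/-- **THE PARTITION OF A RANK CLASS BY CORE SIZE**: `m[k + 1, r] = Σ_{s ≤ k + 1} #nuSets (k + 1) (k + 1 − r) s`. -/
theorem ncard_rkSets_eq_sum_nuSets (k r : ℕ) (hr : r ≤ k + 1) :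
    (S1.rkSets M (k + 1) r).ncard = ∑ s ∈ Finset.range (k + 2), (nuSets M (k + 1) (k + 1 - r) s).ncard := by
  have h := sum_rkSets_core_eq (M := M) k r hr (fun _ => 1)
  simp only [one_mul] at h
  rw [← h, Finset.sum_const, smul_eq_mul, mul_one, ncard_eq_toFinset_card _ (S1.rkSets_finite (k + 1) r)]

/-- The rank classes of one size are disjoint subsets of the `k`-subsets: `Σ_{r ∈ R} m[k, r] ≤ C(n, k)`. -/
theorem sum_ncard_rkSets_le_choose (k : ℕ) (R : Finset ℕ) :
    ∑ r ∈ R, (S1.rkSets M k r).ncard ≤ M.E.ncard.choose k := by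
  have hsub : (⋃ r ∈ (R : Set ℕ), S1.rkSets M k r) ⊆ {A : Set α | A ⊆ M.E ∧ A.ncard = k} := by
    intro A hA
    rw [mem_iUnion₂] at hA
    obtain ⟨r, -, hAr⟩ := hA
    exact ⟨hAr.1, hAr.2.1⟩
  have hdisj : (R : Set ℕ).PairwiseDisjoint (fun r => S1.rkSets M k r) := by
    intro r _ r' _ hrr'
    rw [Function.onFun, Set.disjoint_left]
    rintro A ⟨-, -, hAr⟩ ⟨-, -, hAr'⟩
    apply hrr'
    have h := hAr.symm.trans hAr'
    exact_mod_cast h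
  have heq := R.finite_toSet.ncard_biUnion (s := fun r => S1.rkSets M k r) (fun r _ => S1.rkSets_finite k r) hdisj
  rw [finsum_mem_coe_finset] at heq
  rw [← heq, ← S1.ncard_setOf_subset_ncard_eq M.ground_finite k]
  exact ncard_le_ncard hsub (M.ground_finite.finite_subsets.subset (fun _ h => h.1))

end Partition

section USets

/-- The `U`-sets of size `k`: the `k`-sets `B` of rank `q` whose complement has rank `p`. -/
def uSets (M : Matroid α) (p q k : ℕ) : Set (Set α) :=
  {B : Set α | B ⊆ M.E ∧ B.ncard = k ∧ M.eRk B = (q : ℕ∞) ∧ M.eRk (M.E \ B) = (p : ℕ∞)}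

/-- `uSets` is finite. -/
theorem uSets_finite (p q k : ℕ) : (uSets M p q k).Finite :=
  M.ground_finite.finite_subsets.subset (fun _ h => h.1)

/-- **`#U(p, q) = Σ_{k ≤ n} #uSets k`** — the complements of the `U`-sets, by size. -/
theorem topCount_eq_sum_uSets (p q : ℕ) :
    Matroid.topCount M p q = ∑ k ∈ Finset.range (M.E.ncard + 1), (uSets M p q k).ncard := by
  unfold Matroid.topCount
  have hcompl : {A : Set α | A ⊆ M.E ∧ M.eRk A = (p : ℕ∞) ∧ M.eRk (M.E \ A) = (q : ℕ∞)}.ncard =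
      {B : Set α | B ⊆ M.E ∧ M.eRk B = (q : ℕ∞) ∧ M.eRk (M.E \ B) = (p : ℕ∞)}.ncard := by
    have h := S1.ncard_setOf_compl_eq M.E (fun A => M.eRk A = (p : ℕ∞) ∧ M.eRk (M.E \ A) = (q : ℕ∞))
    rw [← h]
    congr 1
    ext B
    simp only [mem_setOf_eq]
    constructor
    · rintro ⟨hB, h1, h2⟩
      rw [sdiff_sdiff_cancel_left hB] at h2
      exact ⟨hB, h2, h1⟩
    · rintro ⟨hB, h1, h2⟩
      refine ⟨hB, h2, ?_⟩
      rw [sdiff_sdiff_cancel_left hB]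
      exact h1
  rw [hcompl]
  set W := {B : Set α | B ⊆ M.E ∧ M.eRk B = (q : ℕ∞) ∧ M.eRk (M.E \ B) = (p : ℕ∞)} with hW
  have hWfin : W.Finite := M.ground_finite.finite_subsets.subset (fun _ h => h.1)
  have heq : W = ⋃ k ∈ ((Finset.range (M.E.ncard + 1) : Finset ℕ) : Set ℕ), uSets M p q k := by
    ext B
    simp only [hW, mem_setOf_eq, mem_iUnion, Finset.mem_coe, Finset.mem_range, uSets, exists_prop]
    constructor
    · rintro ⟨hB, h1, h2⟩
      exact ⟨B.ncard, Nat.lt_succ_of_le (ncard_le_ncard hB M.ground_finite), hB, rfl, h1, h2⟩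
    · rintro ⟨k, -, hB, -, h1, h2⟩
      exact ⟨hB, h1, h2⟩
  have hdisj : ((Finset.range (M.E.ncard + 1) : Finset ℕ) : Set ℕ).PairwiseDisjoint (fun k => uSets M p q k) := by
    intro k _ k' _ hkk'
    rw [Function.onFun, Set.disjoint_left]
    rintro B ⟨-, h1, -⟩ ⟨-, h2, -⟩
    exact hkk' (h1.symm.trans h2)
  rw [heq, (Finset.range (M.E.ncard + 1)).finite_toSet.ncard_biUnion (fun k _ => uSets_finite p q k) hdisj,
    finsum_mem_coe_finset]

/-- `#uSets k ≤ m[k, q]`. -/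
theorem ncard_uSets_le_rkSets (p q k : ℕ) : (uSets M p q k).ncard ≤ (S1.rkSets M k q).ncard :=
  ncard_le_ncard (fun _ h => ⟨h.1, h.2.1, h.2.2.1⟩) (S1.rkSets_finite k q)

/-- **`#uSets k ≤ m[n − k, p]`**: the complement of a `U`-set is an `(n − k)`-set of rank `p`. -/
theorem ncard_uSets_le_rkSets_compl (p q k : ℕ) :
    (uSets M p q k).ncard ≤ (S1.rkSets M (M.E.ncard - k) p).ncard := by
  refine ncard_le_ncard_of_injOn (fun B => M.E \ B) ?_ ?_ (S1.rkSets_finite _ _)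
  · rintro B ⟨hB, hBk, -, hBp⟩
    refine ⟨sdiff_subset, ?_, hBp⟩
    rw [ncard_sdiff' hB M.ground_finite, hBk]
  · rintro B ⟨hB, -, -, -⟩ B' ⟨hB', -, -, -⟩ h
    simp only at h
    have := congrArg (fun X => M.E \ X) h
    simp only [sdiff_sdiff_cancel_left hB, sdiff_sdiff_cancel_left hB'] at this
    exact this

end USets

section Closure

/-- **THE CLOSURE INSTANCE WITH THE COLOOP-FREE FLAT BOUND**: in a coloop-free matroid of rank `p` on `n` points,
`Σ_s s·#nuSets (k+1) (k − b + 1) s ≤ (n − (p − b + 1) − k)·m[k, b]` for `b ≤ k`, `b < p`. -/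
theorem cl_exact_coloops {p : ℕ} (hM : M.eRank = (p : ℕ∞)) (hcol : M.coloops = ∅) (k b : ℕ) (hb : b ≤ k)
    (hbp : b < p) :
    ∑ s ∈ Finset.range (k + 2), s * (nuSets M (k + 1) (k - b + 1) s).ncard ≤
      (M.E.ncard - (p - b + 1) - k) * (S1.rkSets M k b).ncard := by
  refine closure_exact k b _ hb ?_
  intro A hAE hAk hAb
  have := S1.ncard_extensions_add_le_of_coloops hM hcol hAE hAb hbp
  omega

/-- **THE CLOSURE INSTANCE WITH A FLAT BOUND**: if every set of rank `≤ b` has at most `F` points,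
`Σ_s s·#nuSets (k+1) (k − b + 1) s ≤ (F − k)·m[k, b]` for `b ≤ k`. -/
theorem cl_exact_flat {b F : ℕ} (hflat : ∀ X ⊆ M.E, M.eRk X ≤ (b : ℕ∞) → X.ncard ≤ F) (k : ℕ) (hb : b ≤ k) :
    ∑ s ∈ Finset.range (k + 2), s * (nuSets M (k + 1) (k - b + 1) s).ncard ≤
      (F - k) * (S1.rkSets M k b).ncard := by
  refine closure_exact k b _ hb ?_
  intro A hAE hAk hAb
  have := S1.ncard_extensions_add_le_of_flat hflat hAE hAb
  omega

end Closure

end S2LP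

end PercRepro
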